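import Mathlib
import Summits.Ventures.PercRepro.TriangleCapRowPlusSixF

/-!
# PercRepro — THE CELLS `(20, 26)` OF THE `K₄⁻`-FREE CHERRY TABLE (`t = 7`; module TriangleCapRowPlusSixG)
(p3, gen 32 — the row `m = k + 6` below its threshold `k = 24`, cell by cell)

Each cell `(k, k − 1 + t)` with `t + 3 ≤ k` carries the bipartite value `C(k − 2, 2) + C(t + 1, 2) + t + 1` of `K_{2,t+1}` plus
`k − t − 3` pendant edges, and closes by TriangleCapSevenTen's cell template: all degrees `≤ 4` give `cherries ≤ 3m`; at a vertex
of maximum degree `d ≥ 5` the count needs `Y ≥ 2T + 4(g − 1)(t + 2 − d)` (`g = k − 1 − d`), which the dominating case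
(`T = |R| = 2t`), the matching pairs alone (`Y ≥ (t − 1)T`, for `d ≥ t + 2`), the defect sum seen from a vertex of maximum
off-degree `δ ≥ 5`, or the split sum (`δ ≤ 4`) supply.  Generated from the plan mining/p3/g32/gen_cells.py (every case
checked there before being written).  Axioms: standard.
-/

namespace PercRepro

namespace TriangleCap

namespace C047

open Finset

variable {V : Type*} [Fintype V] [DecidableEq V]

/-- **THE ROW `m = k + 6`, EXACT FOR EVERY `k ≥ 10`:** the maximum is `C(k − 1, 2) + 14 + (24 − k)` — the bipartite
value of `K_{2,8}` plus `k − 10` pendant edges below the threshold `k = 24`, the star value `C(k − 1, 2) + 14` from it on. -/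
theorem row_plus_6_from_10 (k : ℕ) (hk : 10 ≤ k) :
    (∀ (D : SimpleGraph (Fin k)) [DecidableRel D.Adj], K4mFree D → D.edgeFinset.card = k + 6 →
        cherries D ≤ (k - 1).choose 2 + 14 + (24 - k)) ∧
      ∃ (D : SimpleGraph (Fin k)) (_ : DecidableRel D.Adj), K4mFree D ∧ D.edgeFinset.card = k + 6 ∧
        cherries D = (k - 1).choose 2 + 14 + (24 - k) := by
  rcases (by omega : k = 10 ∨ k = 11 ∨ k = 12 ∨ k = 13 ∨ k = 14 ∨ k = 15 ∨ k = 16 ∨ k = 17 ∨ k = 18 ∨ k = 19 ∨ k = 20 ∨ (21 ≤ k ∧ k ≤ 23) ∨ 24 ≤ k)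
    with rfl | rfl | rfl | rfl | rfl | rfl | rfl | rfl | rfl | rfl | rfl | ⟨hlo, hhi⟩ | hthr
  · obtain ⟨h1, D, inst, hK, hD, hc⟩ := cell_exact_10_16
    have e : (10 - 1).choose 2 = 36 := by decide
    exact ⟨fun D _ hK hD => by have := h1 D hK hD; omega, D, inst, hK, hD, by omega⟩
  · obtain ⟨h1, D, inst, hK, hD, hc⟩ := cell_exact_11_17
    have e : (11 - 1).choose 2 = 45 := by decide
    exact ⟨fun D _ hK hD => by have := h1 D hK hD; omega, D, inst, hK, hD, by omega⟩
  · obtain ⟨h1, D, inst, hK, hD, hc⟩ := cell_exact_12_18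
    have e : (12 - 1).choose 2 = 55 := by decide
    exact ⟨fun D _ hK hD => by have := h1 D hK hD; omega, D, inst, hK, hD, by omega⟩
  · obtain ⟨h1, D, inst, hK, hD, hc⟩ := cell_exact_13_19
    have e : (13 - 1).choose 2 = 66 := by decide
    exact ⟨fun D _ hK hD => by have := h1 D hK hD; omega, D, inst, hK, hD, by omega⟩
  · obtain ⟨h1, D, inst, hK, hD, hc⟩ := cell_exact_14_20
    have e : (14 - 1).choose 2 = 78 := by decide
    exact ⟨fun D _ hK hD => by have := h1 D hK hD; omega, D, inst, hK, hD, by omega⟩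
  · obtain ⟨h1, D, inst, hK, hD, hc⟩ := cell_exact_15_21
    have e : (15 - 1).choose 2 = 91 := by decide
    exact ⟨fun D _ hK hD => by have := h1 D hK hD; omega, D, inst, hK, hD, by omega⟩
  · obtain ⟨h1, D, inst, hK, hD, hc⟩ := cell_exact_16_22
    have e : (16 - 1).choose 2 = 105 := by decide
    exact ⟨fun D _ hK hD => by have := h1 D hK hD; omega, D, inst, hK, hD, by omega⟩
  · obtain ⟨h1, D, inst, hK, hD, hc⟩ := cell_exact_17_23
    have e : (17 - 1).choose 2 = 120 := by decide
    exact ⟨fun D _ hK hD => by have := h1 D hK hD; omega, D, inst, hK, hD, by omega⟩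
  · obtain ⟨h1, D, inst, hK, hD, hc⟩ := cell_exact_18_24
    have e : (18 - 1).choose 2 = 136 := by decide
    exact ⟨fun D _ hK hD => by have := h1 D hK hD; omega, D, inst, hK, hD, by omega⟩
  · obtain ⟨h1, D, inst, hK, hD, hc⟩ := cell_exact_19_25
    have e : (19 - 1).choose 2 = 153 := by decide
    exact ⟨fun D _ hK hD => by have := h1 D hK hD; omega, D, inst, hK, hD, by omega⟩
  · obtain ⟨h1, D, inst, hK, hD, hc⟩ := cell_exact_20_26
    have e : (20 - 1).choose 2 = 171 := by decide
    exact ⟨fun D _ hK hD => by have := h1 D hK hD; omega, D, inst, hK, hD, by omega⟩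
  · obtain ⟨h1, h2⟩ := rows_below_exact 7 k (24 - k) (by norm_num) (by omega) (by omega)
    exact ⟨fun D _ hK hD => by have := h1 D hK (by omega); omega, by
      obtain ⟨D, inst, hK, hD, hc⟩ := h2
      exact ⟨D, inst, hK, by omega, by omega⟩⟩
  · obtain ⟨h1, h2⟩ := rows_exact 7 k (by norm_num) (by omega) (by omega)
    have e : 24 - k = 0 := by omega
    rw [e]
    exact ⟨fun D _ hK hD => by have := h1 D hK (by omega); omega, by
      obtain ⟨D, inst, hK, hD, hc⟩ := h2
      exact ⟨D, inst, hK, by omega, by omega⟩⟩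

end C047

end TriangleCap

end PercRepro
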